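import Literature.Barriers.AtomisticToContinuum.HardDiskSwapSymmetry
import HarnessLib

/-!
# The Mapping Theorem for homeomorphic images of Poisson point processes

Topic `Analysis/FunctionSpaces` (companion of `PoissonPointProcess.lean`). Kingman, *Poisson
Processes* (1993), §2.3, **Mapping Theorem** (p. 18): if `Π` is a Poisson process with mean
measure `μ` on `S` and `f : S → T` is measurable such that the image measure `μ* = μ ∘ f⁻¹` has no
atoms (and is suitably finite), then `f(Π)` is a Poisson process on `T` with mean measure `μ*`;
the computation (2.24)–(2.26) preceding it shows that for an INJECTIVE `f` the counts of the image
are `N*(B) = N(f⁻¹ B)`, Poisson of mean `μ(f⁻¹ B)`, and independent over disjoint `Bᵢ` — no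
non-atomicity or finiteness hypothesis is then needed. `PoissonPointProcessProofs.lean` does this
for translations (`IsPoissonPointProcess.translate_holds`); this file does it for an arbitrary
HOMEOMORPHISM `e : E ≃ₜ E'` (dilations, rotations, reflections and similarities of `ℂ`, Möbius
maps between spheres, …), which is what scale- and isometry-covariance statements about
Poisson-driven random geometry (Poisson–Voronoi / Delaunay models) consume.

The image configuration `PointConfig.mapHomeomorph e c = e '' c` with `count_mapHomeomorph`
(`N_{e(c)}(s) = N_c(e⁻¹ s)`) and `measurable_mapHomeomorph` already exists in the tree, declared
(as a generic dot-notation extension) from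
`Literature/Barriers/AtomisticToContinuum/HardDiskSwapSymmetry.lean`; it is imported and reused,
not redefined.

## Contents (namespace `Literature.Analysis.FunctionSpaces`)

* `PointConfig.coe_mapHomeomorph`, `mapHomeomorph_refl`, `mapHomeomorph_trans` (functoriality),
  `mapHomeomorph_addRight` (the translation `PointConfig.translate v` is the image under
  `Homeomorph.addRight v`);
* `PointConfig.mapHomeomorphEquiv e : PointConfig E ≃ᵐ PointConfig E'` — the configuration
  spaces over homeomorphic Borel spaces are measurably equivalent (count σ-algebras), whence
  `measurableEmbedding_mapHomeomorph` (used for `essSup`/a.e. transport without measurability of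
  the transported functional: `MeasurableEmbedding.essSup_map_measure`);
* `IsPoissonPointProcess.mapHomeomorph` — **Mapping Theorem for homeomorphisms**: the image of a
  Poisson point process with intensity `ν` is a Poisson point process with intensity `ν.map e`.

No definitions of mathematical content beyond the equivalence packaging; no named facts.
(Uniqueness in law, `IsPoissonPointProcess.unique_holds`, then identifies the image law with any
other Poisson law of intensity `ν.map e`.)

## References

* J. F. C. Kingman, *Poisson Processes*, Oxford Studies in Probability 3, OUP (1993), §2.3 The
  Mapping Theorem, p. 18, (2.24)–(2.26). [`Kingman1993`]
* G. Last, M. Penrose, *Lectures on the Poisson Process*, CUP (2017), Theorem 5.1 (mapping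
  theorem). [`LastPenrose2017`]
-/

open MeasureTheory ProbabilityTheory Set Function
open scoped ENNReal NNReal

namespace Literature.Analysis.FunctionSpaces

variable {E E' E'' : Type*} [TopologicalSpace E] [TopologicalSpace E'] [TopologicalSpace E'']

namespace PointConfig

/-- The image configuration "is" the image set. [cite: Kingman1993, §2.3] -/
@[simp] lemma coe_mapHomeomorph (e : E ≃ₜ E') (c : PointConfig E) :
    ((c.mapHomeomorph e : PointConfig E') : Set E') = e '' (c : Set E) := rfl

/-- The identity homeomorphism acts trivially. [folklore] -/
@[simp] theorem mapHomeomorph_refl (c : PointConfig E) :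
    c.mapHomeomorph (Homeomorph.refl E) = c := by
  ext x; simp [mem_mapHomeomorph_iff]

/-- Functoriality: the image under a composite is the iterated image. [folklore] -/
theorem mapHomeomorph_trans (e : E ≃ₜ E') (e' : E' ≃ₜ E'') (c : PointConfig E) :
    c.mapHomeomorph (e.trans e') = (c.mapHomeomorph e).mapHomeomorph e' := by
  ext x; simp [mem_mapHomeomorph_iff]

/-- Translation is the image under the homeomorphism `x ↦ x + v`. [cite: Kingman1993, §2.3] -/
theorem mapHomeomorph_addRight [AddGroup E] [ContinuousAdd E] (v : E) (c : PointConfig E) :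
    c.mapHomeomorph (Homeomorph.addRight v) = c.translate v := by
  ext x
  change x ∈ (Homeomorph.addRight v) '' c.carrier ↔ x ∈ (· + v) '' c.carrier
  rfl

variable [MeasurableSpace E] [MeasurableSpace E'] [BorelSpace E] [BorelSpace E']

/-- **The configuration spaces over homeomorphic Borel spaces are measurably equivalent**:
`c ↦ e(c)` with inverse `c ↦ e⁻¹(c)`, both measurable for the count σ-algebras. [folklore] -/
noncomputable def mapHomeomorphEquiv (e : E ≃ₜ E') : PointConfig E ≃ᵐ PointConfig E' where
  toFun := PointConfig.mapHomeomorph e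
  invFun := PointConfig.mapHomeomorph e.symm
  left_inv := mapHomeomorph_mapHomeomorph_symm e
  right_inv := mapHomeomorph_symm_mapHomeomorph e
  measurable_toFun := measurable_mapHomeomorph e
  measurable_invFun := measurable_mapHomeomorph e.symm

/-- The measurable equivalence is the image map. [folklore] -/
@[simp] theorem coe_mapHomeomorphEquiv (e : E ≃ₜ E') :
    ⇑(mapHomeomorphEquiv e) = PointConfig.mapHomeomorph e := rfl

/-- Its inverse is the image map of the inverse homeomorphism. [folklore] -/
@[simp] theorem coe_mapHomeomorphEquiv_symm (e : E ≃ₜ E') :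
    ⇑(mapHomeomorphEquiv e).symm = PointConfig.mapHomeomorph e.symm := rfl

/-- The image map is a measurable embedding. [folklore] -/
theorem measurableEmbedding_mapHomeomorph (e : E ≃ₜ E') :
    MeasurableEmbedding (PointConfig.mapHomeomorph e : PointConfig E → PointConfig E') :=
  (mapHomeomorphEquiv e).measurableEmbedding

/-- Image laws transform all sets exactly: `(P.map e(·)) A = P (e(·) ⁻¹' A)` for EVERY
`A ⊆ PointConfig E'` (measurable or not), as for any measurable equivalence. [folklore] -/
theorem map_mapHomeomorph_apply (e : E ≃ₜ E') (P : Measure (PointConfig E))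
    (A : Set (PointConfig E')) :
    P.map (PointConfig.mapHomeomorph e) A = P (PointConfig.mapHomeomorph e ⁻¹' A) :=
  (mapHomeomorphEquiv e).map_apply A

end PointConfig

/-! ### The Mapping Theorem for homeomorphisms -/

namespace IsPoissonPointProcess

variable [MeasurableSpace E] [MeasurableSpace E'] {ν : Measure E} {P : Measure (PointConfig E)}

/-- Independence transports along a measurable change of variables: if the `g i ∘ T` are
independent under `μ`, the `g i` are independent under `μ.map T` (a local copy of the private
lemma of `PoissonPointProcessProofs.lean`). [folklore] -/
private theorem iIndepFun_map_of_comp {Ω Ω' ι : Type*} [MeasurableSpace Ω] [MeasurableSpace Ω']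
    {β : ι → Type*} [∀ i, MeasurableSpace (β i)] {μ : Measure Ω} {T : Ω → Ω'}
    (hT : Measurable T) {g : ∀ i, Ω' → β i} (hg : ∀ i, Measurable (g i))
    (h : iIndepFun (fun i => g i ∘ T) μ) : iIndepFun g (μ.map T) := by
  rw [iIndepFun_iff_measure_inter_preimage_eq_mul] at h ⊢
  intro S sets hsets
  have hmeas : ∀ i ∈ S, MeasurableSet (g i ⁻¹' sets i) := fun i hi => hg i (hsets i hi)
  have h1 : ∀ i ∈ S, μ.map T (g i ⁻¹' sets i) = μ ((g i ∘ T) ⁻¹' sets i) := fun i hi => by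
    rw [Measure.map_apply hT (hmeas i hi), Set.preimage_comp]
  rw [Finset.prod_congr rfl h1, Measure.map_apply hT (Finset.measurableSet_biInter S hmeas),
    Set.preimage_iInter₂]
  simpa only [Set.preimage_comp] using h S hsets

/-- **Mapping Theorem for homeomorphisms** (Kingman 1993, §2.3, p. 18, via (2.24)–(2.26) for the
injective measurable map `f = e`): the image `e(Π)` of a Poisson point process `Π` with intensity
`ν` is a Poisson point process with intensity the image measure `ν.map e`. Indeed
`N*(B) = N(e⁻¹ B)` (`PointConfig.count_mapHomeomorph`) is Poisson with mean `ν (e⁻¹ B)`, and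
disjoint `B₁, …, Bₙ` have disjoint preimages, so the `N*(Bᵢ)` are independent; no σ-finiteness or
non-atomicity hypothesis is needed in this injective case. Only measurability of `e` is used.
[cite: Kingman1993, §2.3 Mapping Theorem, p. 18, (2.24)–(2.26)] -/
theorem mapHomeomorph (h : IsPoissonPointProcess ν P) (e : E ≃ₜ E') (he : Measurable e)
    (hT : Measurable (PointConfig.mapHomeomorph e : PointConfig E → PointConfig E')) :
    IsPoissonPointProcess (ν.map e) (P.map (PointConfig.mapHomeomorph e)) := by
  haveI := h.isProbabilityMeasure
  refine ⟨Measure.isProbabilityMeasure_map hT.aemeasurable, fun s hs hfin => ?_,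
    fun n s hs hd => ?_⟩
  · rw [Measure.map_apply he hs] at hfin ⊢
    have hcomp : (fun c : PointConfig E' => c.count s) ∘ PointConfig.mapHomeomorph e =
        fun c : PointConfig E => c.count (e ⁻¹' s) :=
      funext fun c => PointConfig.count_mapHomeomorph e c s
    rw [Measure.map_map (PointConfig.measurable_count hs) hT, hcomp]
    exact h.map_count (he hs) hfin
  · refine iIndepFun_map_of_comp hT (fun i => PointConfig.measurable_count (hs i)) ?_
    have hcomp : (fun i => (fun c : PointConfig E' => c.count (s i)) ∘ PointConfig.mapHomeomorph e)
        = fun i (c : PointConfig E) => c.count (e ⁻¹' s i) := by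
      funext i c
      exact PointConfig.count_mapHomeomorph e c (s i)
    rw [hcomp]
    exact h.iIndepFun_count (fun i => he (hs i)) fun i j hij => (hd hij).preimage e

/-- **Mapping Theorem for homeomorphisms**, Borel form: over Borel spaces both measurability
hypotheses of `mapHomeomorph` are automatic. [cite: Kingman1993, §2.3 Mapping Theorem, p. 18] -/
theorem mapHomeomorph' [BorelSpace E] [BorelSpace E'] (h : IsPoissonPointProcess ν P)
    (e : E ≃ₜ E') :
    IsPoissonPointProcess (ν.map e) (P.map (PointConfig.mapHomeomorph e)) :=
  h.mapHomeomorph e e.measurable (PointConfig.measurable_mapHomeomorph e)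

end IsPoissonPointProcess

end Literature.Analysis.FunctionSpaces
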